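/-
Copyright (c) 2026 the pub-hodgecm-mathlib formalisation cell (harness21).  Prover seat hodgecm-mathlib-K2E4-p13 (g0),
Track B «K2-LIT» ∕ h413, ENGINE E4 — #10♯ last mile, brick (B) `K2E4ArchFramePairIdentification` (K2E4-plan deal 23:49:50Z).  2026-09-03.
-/
import Literature.NumberTheory.Rogawski1990.ArchEndoscopicSemiregularCentre         -- ★ p854854 (this seat): the `H_∞`-side identifications of the semiregular centre (`γ_H ⊗ 1` in circle coordinates)
import Literature.NumberTheory.Automorphic.ArchCongruenceOrbitalTransport           -- ★ `coe_archCongrOfEq_apply`: the congruence `Φ_P` acts by `g ↦ σ(P) g σ(P)⁻¹`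
import Literature.NumberTheory.Automorphic.ArchDiagonalTorus                        -- ★ `archDiagTorus`, `coe_archDiagTorus_eq_diagonal`
import Literature.NumberTheory.Rogawski1990.AdelicStableOrbitalEulerDischargeSemisimple  -- ★ `coe_cmRationalToArch_eq_map` (`γ ⊗ 1` is the entrywise `mixedEmbedding` image)
import HarnessLib

/-!
# K2 · E4 — #10♯ last mile, (B): THE FRAME PAIR IDENTIFICATION `(h₀, Φ_P t) = ((γ_H.1 ⊗ 1, γ_H.2 ⊗ 1), γ₀′ ⊗ 1)`
# (Rogawski 1990 §8.2 p. 118 (`γ₀ ∼ (e₁, e₁, e₂)`, `γ_H = (e₁·1₂, e₂)`), §3.8 Prop. 3.8.1 (a) p. 27; Borel–Jacquet 1979 §4.1)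

Cell `pub/hodgecm-mathlib` (D-0151), HCML Track B, crux H413 = `stmt-HodgeConjecture-24833`; prover seat `hodgecm-mathlib-K2E4-p13` (g0), DEALT BY NAME by K2E4-plan (g0) 2026-09-03T23:49:50Z
(«(B) `Theorems/K2E4ArchFramePairIdentification.lean` (M): `Φ_P t = cmRationalToArch L 3 H' γ₀′` (membership of `P·diag(e₁,e₂,e₁)·P⁻¹` in `unitaryGroup (cmConjRingHom L) H'` from
`formCongr P H' = diag α′` + `c(eᵢ)eᵢ = 1`; arch embedding commutes with conjugation by `P`) and the `h₀ = (cmRationalToArch … γH.1, … γH.2)` rewrite»); consumed by K2E4-p14's (C)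
`K2E4SignedNineOfFrameExport` (conversion of K2E4-p09's signed export to ★ p855349's hypothesis) — `--supports … --as helper`.

WHAT.  K2E4-p09's signed #9 export reads the archimedean factor at the pair `(h₀, Φ_P t)` of the INTERNAL rational diagonal frame `(P, α′)` of ★ `exists_formCongr_eq_diagonal`
(`formCongr c P H′ = diag α′`, `Φ_P = unitaryGroupOfFormCongrOfEq … (GL.map (mixedEmbedding L) P) (archFormOf L 3 H′) (archFormOf L 3 (diag α′)) …` of ★ `coe_archCongrOfEq_apply`,
`t = t_{α′}(z)` a torus point, `h₀ = (Ψ_{Q₂}⁻¹ t₂(σe₁, σe₁), e₁⁻¹ diag(σe₂))`); socket #10♯ speaks about the RATIONAL pair `((γ_H.1 ⊗ 1, γ_H.2 ⊗ 1), γ₀ ⊗ 1)` (★ `cmRationalToArch`).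
This file identifies them:
* §1 **`conj_diagonal_mem_unitaryGroup`** — `P · diag(d) · P⁻¹ ∈ U(H′)(L⁺)` for `formCongr c P H′ = diag α′` and `c(dᵢ) dᵢ = 1` (★ `conj_mem_unitaryGroupOfForm`): the rational
  element `γ₀′` exists for EVERY unit-circle diagonal `d` (so also for the permuted frames K2E4-p14 needs);
* §2 **`coe_cmRationalToArch_eq_conj_archDiagTorus`** — if `γ ∈ U(H′)(L⁺)` has matrix `P · diag(d) · P⁻¹` and `σ_w(dᵢ) = z_{w,i}`, then `γ ⊗ 1 = σ(P) · t_{α′}(z) · σ(P)⁻¹` in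
  `GL₃(L ⊗ ℝ)` (★ `coe_cmRationalToArch_eq_map`, ★ `coe_archDiagTorus_eq_diagonal`, ★ `mixedSpace_ext`); **`archCongrOfEq_archDiagTorus_eq_cmRationalToArch`** — hence
  `Φ_P (t_{α′}(z)) = γ ⊗ 1` in `U(H′)_∞` (★ `coe_archCongrOfEq_apply`, `Subtype.ext`);
* §3 **`hPair_eq_cmRationalToArch`** — `h₀ = (γ_H.1 ⊗ 1, γ_H.2 ⊗ 1)` for every rational pair with `γ_H.1 = e₁•1₂`, `(γ_H.2)₀₀ = e₂` (★ p854854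
  `congr_cmRationalToArch_two_eq_archDiagTorus_of_coe_two_eq_smul_one` at the quasi-split frame `Ψ_{Q₂}` + `cmRationalToArch_one_eq_symm_circleDiagonal_of_apply_zero_zero_eq`), with `h₀`
  in the EXACT tokens of ★ p855382 `GPrimeDataSigned.lam_phase`.
HONEST LABEL: HC_CM is proved only modulo the 7 printed citations (2 remaining named inputs: hLiu418 = stmt-HodgeConjecture-24832, h413 = stmt-HodgeConjecture-24833) until rung 0 closes; this
file is frame bookkeeping and pays no socket by itself.

## References
* [Rogawski1990] J. D. Rogawski, *Automorphic Representations of Unitary Groups in Three Variables*, Ann. of Math. Stud. 123 (1990), §8.2 Prop. 8.2.1 (a) p. 118; §3.8 Prop. 3.8.1 (a)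
  p. 27; §14.5 Lemma 14.5.2 (b) p. 238.
* [BorelJacquet1979] A. Borel, H. Jacquet, *Automorphic forms and automorphic representations*, PSPM 33.1 (1979), §4.1.
* [PlatonovRapinchuk1994] V. Platonov, A. Rapinchuk, *Algebraic Groups and Number Theory* (1994), §2.3.
-/

set_option autoImplicit false
set_option linter.dupNamespace false  -- the cell's namespace convention `Summit.HodgeConjecture.HodgeConjecture.Cruxes.H413.<File>` repeats the summit = problem name

noncomputable section

open NumberField NumberField.InfinitePlace NumberField.mixedEmbedding Topology Filter Set Function
open Literature.NumberTheory.Automorphic Literature.NumberTheory.Automorphic.UnitaryGroup Literature.NumberTheory.Rogawski1990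
open Literature.AlgebraicGeometry.ShimuraVarieties (unitaryGroup mem_unitaryGroup_iff)
open scoped Matrix MatrixGroups Classical

namespace Summit.HodgeConjecture.HodgeConjecture.Cruxes.H413.K2E4ArchFramePairIdentification

variable (L : Type) [Field L] [NumberField L] [IsCMField L] (H' : Matrix (Fin 3) (Fin 3) L)

/-! ## §1 The rational element `γ₀′ = P · diag(d) · P⁻¹ ∈ U(H′)(L⁺)` -/

/-- A diagonal matrix with unit-circle entries (`c(dᵢ) dᵢ = 1`) has non-zero determinant. [folklore] -/
theorem det_diagonal_ne_zero_of_complexConj_mul_self {N : ℕ} (d : Fin N → L) (hd : ∀ i, (IsCMField.complexConj L (d i) : L) * d i = 1) :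
    (Matrix.diagonal d).det ≠ 0 := by
  rw [Matrix.det_diagonal]
  exact Finset.prod_ne_zero_iff.2 fun i _ h => by simpa [h] using hd i

/-- **`γ₀′ = P · diag(d) · P⁻¹ ∈ U(H′)(L⁺)`** for a rational diagonal frame `σ(P)ᵀ H′ P = diag α′` and unit-circle entries `c(dᵢ) dᵢ = 1`: `diag(d)` preserves `diag α′`
(`c(dᵢ) α′ᵢ dᵢ = α′ᵢ`), and conjugation by the frame carries `U(diag α′)` onto `U(H′)` (★ `conj_mem_unitaryGroupOfForm`).
[cite: Rogawski1990, §3.8 Prop. 3.8.1 (a) p. 27] [cite: PlatonovRapinchuk1994, §2.3] -/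
theorem conj_diagonal_mem_unitaryGroup (P : GL (Fin 3) L) (α' : Fin 3 → L) (hP : formCongr (cmConjRingHom L) P H' = Matrix.diagonal α')
    (d : Fin 3 → L) (hd : ∀ i, (IsCMField.complexConj L (d i) : L) * d i = 1) :
    P * Matrix.GeneralLinearGroup.mkOfDetNeZero (Matrix.diagonal d) (det_diagonal_ne_zero_of_complexConj_mul_self L d hd) * P⁻¹ ∈
      unitaryGroup (cmConjRingHom L) H' := by
  -- `diag(d) ∈ U(diag α′) = U(formCongr P H′)`
  have hD : Matrix.GeneralLinearGroup.mkOfDetNeZero (Matrix.diagonal d) (det_diagonal_ne_zero_of_complexConj_mul_self L d hd) ∈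
      unitaryGroupOfForm (cmConjRingHom L) (formCongr (cmConjRingHom L) P H') := by
    rw [hP, mem_unitaryGroupOfForm_iff]
    change ((Matrix.diagonal d).map (cmConjRingHom L))ᵀ * Matrix.diagonal α' * Matrix.diagonal d = Matrix.diagonal α'
    rw [Matrix.diagonal_map (map_zero _), Matrix.diagonal_transpose, Matrix.diagonal_mul_diagonal, Matrix.diagonal_mul_diagonal]
    congr 1
    funext i
    rw [cmConjRingHom_apply, mul_comm (IsCMField.complexConj L (d i) : L) (α' i), mul_assoc, hd i, mul_one]
  exact (mem_unitaryGroup_iff).2 ((mem_unitaryGroupOfForm_iff).1 (conj_mem_unitaryGroupOfForm (cmConjRingHom L) P H' hD))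

/-! ## §2 `γ ⊗ 1 = σ(P) · t_{α′}(z) · σ(P)⁻¹` and `Φ_P (t_{α′}(z)) = γ ⊗ 1` -/

/-- **THE ARCHIMEDEAN EMBEDDING COMMUTES WITH THE FRAME**: if `γ ∈ U(H′)(L⁺)` has matrix `P · diag(d) · P⁻¹` and `σ_w(dᵢ) = z_{w,i}` at every complex place, then in
`GL₃(L ⊗ ℝ)` one has `γ ⊗ 1 = σ(P) · t_{α′}(z) · σ(P)⁻¹` (entrywise `mixedEmbedding`, ★ `coe_cmRationalToArch_eq_map`; `t_{α′}(z) = diag((0, (z_{w,i})_w))`, ★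
`coe_archDiagTorus_eq_diagonal`; no real places, ★ `mixedSpace_ext`). [cite: BorelJacquet1979, §4.1] [cite: Rogawski1990, §8.2 p. 118] -/
theorem coe_cmRationalToArch_eq_conj_archDiagTorus (P : GL (Fin 3) L) (α' : Fin 3 → L) (d : Fin 3 → L)
    (γ : (UnitaryGroup.cmDatum L 3 H').Rational)
    (hγ : (((γ : unitaryGroup (cmConjRingHom L) H').val : GL (Fin 3) L) : Matrix (Fin 3) (Fin 3) L) =
      (P : Matrix (Fin 3) (Fin 3) L) * Matrix.diagonal d * ((P⁻¹ : GL (Fin 3) L) : Matrix (Fin 3) (Fin 3) L))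
    (z : {w : InfinitePlace L // IsComplex w} → Fin 3 → Circle) (hz : ∀ w i, (z w i : ℂ) = w.1.embedding (d i)) :
    ((cmRationalToArch L 3 H' γ : UnitaryGroup.arch (↥(maximalRealSubfield L)) L (IsCMField.complexConj L) 3 H') : GL (Fin 3) (mixedSpace L)) =
      Matrix.GeneralLinearGroup.map (mixedEmbedding L) P *
        ((archDiagTorus L 3 α' z : UnitaryGroup.arch (↥(maximalRealSubfield L)) L (IsCMField.complexConj L) 3 (Matrix.diagonal α')) : GL (Fin 3) (mixedSpace L)) *
        (Matrix.GeneralLinearGroup.map (mixedEmbedding L) P)⁻¹ := by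
  apply Matrix.GeneralLinearGroup.ext
  intro i j
  have hmat : ((((cmRationalToArch L 3 H' γ).val : GL (Fin 3) (mixedSpace L)).val : Matrix (Fin 3) (Fin 3) (mixedSpace L))) =
      ((P : Matrix (Fin 3) (Fin 3) L).map (mixedEmbedding L)) * Matrix.diagonal (fun i => mixedEmbedding L (d i)) *
        (((P⁻¹ : GL (Fin 3) L) : Matrix (Fin 3) (Fin 3) L).map (mixedEmbedding L)) := by
    rw [coe_cmRationalToArch_eq_map, hγ, Matrix.map_mul, Matrix.map_mul, Matrix.diagonal_map (map_zero _)]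
  have hdiag : Matrix.diagonal (fun i => mixedEmbedding L (d i)) =
      (((archDiagTorus L 3 α' z : UnitaryGroup.arch (↥(maximalRealSubfield L)) L (IsCMField.complexConj L) 3 (Matrix.diagonal α')) :
        GL (Fin 3) (mixedSpace L)) : Matrix (Fin 3) (Fin 3) (mixedSpace L)) := by
    rw [coe_archDiagTorus_eq_diagonal]
    congr 1
    funext i
    refine mixedSpace_ext (↥(maximalRealSubfield L)) L (IsCMField.complexConj L) (IsCMField.complexConj_ne_one L) (complexConj_smul_infinitePlace L) fun w => ?_
    rw [mixedEmbedding_apply_isComplex, ← hz w i]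
  have hinv : ((((Matrix.GeneralLinearGroup.map (mixedEmbedding L) P)⁻¹ : GL (Fin 3) (mixedSpace L)) : Matrix (Fin 3) (Fin 3) (mixedSpace L))) =
      ((P⁻¹ : GL (Fin 3) L) : Matrix (Fin 3) (Fin 3) L).map (mixedEmbedding L) := by
    rw [← map_inv]; rfl
  change ((((cmRationalToArch L 3 H' γ).val : GL (Fin 3) (mixedSpace L)).val : Matrix (Fin 3) (Fin 3) (mixedSpace L))) i j = _
  rw [hmat, hdiag, Units.val_mul, Units.val_mul, hinv]
  rfl

/-- **`Φ_P (t_{α′}(z)) = γ ⊗ 1` IN `U(H′)_∞`** — the congruence `Φ_P : U(diag α′)_∞ ≃ₜ* U(H′)_∞` of the rational frame (the TERM of ★ `coe_archCongrOfEq_apply`, `g ↦ σ(P) g σ(P)⁻¹`)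
maps the torus point `t_{α′}(z)` to the rational point `γ ⊗ 1` whenever `γ = P · diag(d) · P⁻¹`, `σ_w(dᵢ) = z_{w,i}`.  (For K2E4-p09's export: `t = t_{α′}(σe₁, σe₂, σe₁)`,
`γ₀′ = P · diag(e₁, e₂, e₁) · P⁻¹` of §1; for a permuted frame replace `P` by `P · (permutation)`.) [cite: Rogawski1990, §8.2 p. 118; §3.8 Prop. 3.8.1 (a) p. 27] [cite: PlatonovRapinchuk1994, §2.3] -/
theorem archCongrOfEq_archDiagTorus_eq_cmRationalToArch (P : GL (Fin 3) L) (α' : Fin 3 → L) (hP : formCongr (cmConjRingHom L) P H' = Matrix.diagonal α')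
    (d : Fin 3 → L) (γ : (UnitaryGroup.cmDatum L 3 H').Rational)
    (hγ : (((γ : unitaryGroup (cmConjRingHom L) H').val : GL (Fin 3) L) : Matrix (Fin 3) (Fin 3) L) =
      (P : Matrix (Fin 3) (Fin 3) L) * Matrix.diagonal d * ((P⁻¹ : GL (Fin 3) L) : Matrix (Fin 3) (Fin 3) L))
    (z : {w : InfinitePlace L // IsComplex w} → Fin 3 → Circle) (hz : ∀ w i, (z w i : ℂ) = w.1.embedding (d i)) :
    unitaryGroupOfFormCongrOfEq (conjMixed (↥(maximalRealSubfield L)) L (IsCMField.complexConj L)) (Matrix.GeneralLinearGroup.map (mixedEmbedding L) P)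
        (archFormOf L 3 H') (archFormOf L 3 (Matrix.diagonal α')) (formCongr_map_mixedEmbedding_archFormOf_eq L hP) (archDiagTorus L 3 α' z) =
      cmRationalToArch L 3 H' γ := by
  apply Subtype.ext
  rw [coe_archCongrOfEq_apply L hP, coe_cmRationalToArch_eq_conj_archDiagTorus L H' P α' d γ hγ z hz]

/-! ## §3 The `H_∞`-point: `h₀ = (γ_H.1 ⊗ 1, γ_H.2 ⊗ 1)` -/

/-- **THE `H_∞`-POINT OF THE SIGNED EXPORT IS THE RATIONAL `H`-CENTRE `γ_H ⊗ 1`** (tokens of ★ p855382 `GPrimeDataSigned.lam_phase`): for every rational pair `γ_H` with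
`γ_H.1 = e₁•1₂` and `(γ_H.2)₀₀ = e₂` (the sockets' `hγH₁`, `hγH₂`),
`(Ψ_{Q₂}⁻¹ t₂(σe₁, σe₁), e₁⁻¹ diag(σe₂)) = (cmRationalToArch L 2 Φ₂ γ_H.1, cmRationalToArch L 1 Φ₁ γ_H.2)` — ★ p854854's two identifications at the quasi-split frame `Ψ_{Q₂}`.
[cite: Rogawski1990, §8.2 Prop. 8.2.1 (a) p. 118; §14.5 Lemma 14.5.2 (b) p. 238] [cite: BorelJacquet1979, §4.1] -/
theorem hPair_eq_cmRationalToArch (e₁ e₂ : L) (h₁ : (IsCMField.complexConj L e₁ : L) * e₁ = 1) (h₂ : (IsCMField.complexConj L e₂ : L) * e₂ = 1)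
    (γH : (UnitaryGroup.cmDatum L 2 (Matrix.of fun i j : Fin 2 => if i.val + j.val + 1 = 2 then (1 : L) else 0)).Rational ×
      (UnitaryGroup.cmDatum L 1 (Matrix.of fun i j : Fin 1 => if i.val + j.val + 1 = 1 then (1 : L) else 0)).Rational)
    (hγH₁ : (((γH.1 : unitaryGroup (cmConjRingHom L) (Matrix.of fun i j : Fin 2 => if i.val + j.val + 1 = 2 then (1 : L) else 0)).val : GL (Fin 2) L) :
      Matrix (Fin 2) (Fin 2) L) = e₁ • (1 : Matrix (Fin 2) (Fin 2) L))
    (hγH₂ : (((γH.2 : unitaryGroup (cmConjRingHom L) (Matrix.of fun i j : Fin 1 => if i.val + j.val + 1 = 1 then (1 : L) else 0)).val : GL (Fin 1) L) :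
      Matrix (Fin 1) (Fin 1) L) 0 0 = e₂) :
    (((unitaryGroupOfFormCongrOfEq (UnitaryGroup.conjMixed (↥(maximalRealSubfield L)) L (IsCMField.complexConj L))
              (Matrix.GeneralLinearGroup.map (mixedEmbedding L) (Matrix.GeneralLinearGroup.mkOfDetNeZero !![(1 : L), 1; 1, -1] (UnitaryGroup.det_quasiSplitFrameTwo_ne_zero L)))
              (UnitaryGroup.archFormOf L 2 (Matrix.diagonal ![(2 : L)⁻¹, -(2 : L)⁻¹])) (UnitaryGroup.archFormOf L 2 (Matrix.of fun i j : Fin 2 => if i.val + j.val + 1 = 2 then (1 : L) else 0))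
              (UnitaryGroup.formCongr_map_mixedEmbedding_archFormOf_eq L (UnitaryGroup.formCongr_quasiSplitFrameTwo_diagonal L))).symm
              (UnitaryGroup.archDiagTorus L 2 ![(2 : L)⁻¹, -(2 : L)⁻¹] fun w => ![(⟨w.1.embedding e₁, mem_sphere_zero_iff_norm.mpr (UnitaryGroup.norm_embedding_eq_one_of_complexConj_mul_self L e₁ h₁ w)⟩ : Circle), ⟨w.1.embedding e₁, mem_sphere_zero_iff_norm.mpr (UnitaryGroup.norm_embedding_eq_one_of_complexConj_mul_self L e₁ h₁ w)⟩]),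
            (UnitaryGroup.archPiEquivCM 1 L (Matrix.of fun i j : Fin 1 => if i.val + j.val + 1 = 1 then (1 : L) else 0)).symm fun w =>
              ⟨UnitaryGroup.circleDiagonal 1 ![(⟨w.1.embedding e₂, mem_sphere_zero_iff_norm.mpr (UnitaryGroup.norm_embedding_eq_one_of_complexConj_mul_self L e₂ h₂ w)⟩ : Circle)], UnitaryGroup.circleDiagonal_mem_archLocal_antidiagOne L w _⟩) :
        ↥(UnitaryGroup.arch (↥(maximalRealSubfield L)) L (IsCMField.complexConj L) 2 (Matrix.of fun i j : Fin 2 => if i.val + j.val + 1 = 2 then (1 : L) else 0)) ×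
          ↥(UnitaryGroup.arch (↥(maximalRealSubfield L)) L (IsCMField.complexConj L) 1 (Matrix.of fun i j : Fin 1 => if i.val + j.val + 1 = 1 then (1 : L) else 0))) =
      (cmRationalToArch L 2 (Matrix.of fun i j : Fin 2 => if i.val + j.val + 1 = 2 then (1 : L) else 0) γH.1,
        cmRationalToArch L 1 (Matrix.of fun i j : Fin 1 => if i.val + j.val + 1 = 1 then (1 : L) else 0) γH.2) := by
  refine Prod.ext ?_ ?_
  · -- the 2-block: `Ψ_{Q₂}⁻¹ t₂(σe₁, σe₁) = γ_H.1 ⊗ 1` ⟸ `Ψ_{Q₂} (γ_H.1 ⊗ 1) = t₂(σe₁, σe₁)` (★ p854854 at the frame `Ψ_{Q₂}`)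
    apply (ContinuousMulEquiv.symm_apply_eq _).2
    have hconst : (fun w : {w : InfinitePlace L // IsComplex w} =>
        ![(⟨w.1.embedding e₁, mem_sphere_zero_iff_norm.mpr (UnitaryGroup.norm_embedding_eq_one_of_complexConj_mul_self L e₁ h₁ w)⟩ : Circle),
          ⟨w.1.embedding e₁, mem_sphere_zero_iff_norm.mpr (UnitaryGroup.norm_embedding_eq_one_of_complexConj_mul_self L e₁ h₁ w)⟩]) =
        fun w _ => ⟨w.1.embedding e₁, mem_sphere_zero_iff_norm.mpr (UnitaryGroup.norm_embedding_eq_one_of_complexConj_mul_self L e₁ h₁ w)⟩ :=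
      funext fun w => funext fun j => by fin_cases j <;> rfl
    exact (congrArg (UnitaryGroup.archDiagTorus L 2 ![(2 : L)⁻¹, -(2 : L)⁻¹]) hconst).trans
      (congr_cmRationalToArch_two_eq_archDiagTorus_of_coe_two_eq_smul_one _ _
        (fun x => UnitaryGroup.coe_archCongrOfEq_apply L (UnitaryGroup.formCongr_quasiSplitFrameTwo_diagonal L) x) γH.1 hγH₁).symm
  · -- the `U(Φ₁)`-block: ★ p854854
    exact (cmRationalToArch_one_eq_symm_circleDiagonal_of_apply_zero_zero_eq γH.2 hγH₂).symm

end Summit.HodgeConjecture.HodgeConjecture.Cruxes.H413.K2E4ArchFramePairIdentification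

end
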